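import Mathlib
import Summits.NavierStokesRegularity.NavierStokesRegularity.Theorems.EulerZoomLiouvillePowerGaugeEulerLiouvilleSelfSimilarSwirlBernoulli
import Summits.NavierStokesRegularity.NavierStokesRegularity.Theorems.EulerZoomLiouvillePowerGaugeEulerLiouvilleSelfSimilarGlobalTrajectory
import Literature.Analysis.ODE.GlobalExistence
import HarnessLib

/-!
# Crux E `PowerGaugeEulerLiouville` (stmt-NavierStokesRegularity-19832), THE ONE STATEMENT: THE SWIRL RATCHET, VII — GROWTH ONLY ON THE SWIRL SET:
# the orbit-wise swirl kills (bounded swirl, `ℋ` bounded above) need the linear-growth bound only on the invariant set `{swirl V ≠ 0}` (width seat ns-ezl-w3 g3)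

Route №10 `EulerZoomLiouville` (NavierStokesRegularity), crux E; LEAD ns-typeII-p2 g12 (v65: «super-linear growth of `V` has LEFT THE ONE STATEMENT» for the
vortical squeeze — ns-ezl-w5 g2's pinched channels).  The swirl-ratchet kills `…SwirlRatchet.hasNoSwirl_of_bounded_swirl` (p640471) and
`…SwirlBernoulli.hasNoSwirl_of_bernoulli_le` (p643866) used the global linear growth `‖V y‖ ≤ K₁(1+‖y‖)` for exactly two things: the EXISTENCE of a global backward
similarity orbit from a swirling point, and the size of `Γ = swirl V` ALONG that orbit.  The orbit never leaves the swirl set `{Γ ≠ 0}` (the ratchet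
`Γ(Y t) = e^{(1−2γ)t}Γ(y)` holds on every solution SEGMENT — `swirl_backward_segment`), so the growth bound is only ever evaluated on `{Γ ≠ 0}`; and global existence
follows from the tree's continuation principle (`Literature.Analysis.ODE.exists_solution_Ici_of_apriori_bound`) with Grönwall's a-priori bound computed ON THE SWIRL SET
(`exists_backward_orbit_of_swirlGrowth`).  Hence:

* `SwirlRatchet.hasNoSwirl_of_bounded_swirl_local` — `γ < ½`, axisymmetric `C²` profile, `‖V y‖ ≤ K₁(1+‖y‖)` FOR `swirl V y ≠ 0` ONLY, `|swirl V| ≤ B` ⇒ swirl-free.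
* `SwirlRatchet.hasNoSwirl_of_bernoulli_le_local` — same growth hypothesis, `ℋ_P ≤ Mb` on the swirl set ⇒ swirl-free (the (A1)+ratchet lever of `…SwirlBernoulli`).
* MEMBER FORMS `…_of_axisym_boundedSwirl_C2_local`, `…_of_axisym_bernoulliBounded_C2_local` — crux binders + exactly self-similar ansatz + `ContDiff ℝ 2 V` + `IsAxisymmetric V` +
  `∃ K₁, ∀ y, swirl V y ≠ 0 → ‖V y‖ ≤ K₁(1+‖y‖)` + (bounded swirl | `ℋ` bounded above on the swirl set for every classical pressure) ⇒ `u = 0` a.e.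
  For the LEAD: in `IsTameSwirl ρ V` the linear-growth conjunct may be read ON THE SWIRL SET for these two disjuncts (super-linear growth OFF the swirl set is irrelevant to them).

WHAT THIS IS NOT: not NS regularity, not the crux E — a sharpening of two strata of the crux CLASS 19832 (MODEL lattice; E/NS strata) `--supports` stmt-19832; the volume-law strata
(finite support, Casimirs) keep the global growth bound (cut-off flows); 19832 OPEN.  [folklore; Hartman2002 Ch. II Thm. 3.1; Chae2007CMPEuler Thm 2.2;
ConstantinIgnatovaVicol2026Putative §3.4.3]
-/

noncomputable section

-- flat `Theorems/<Route><Decl>…` files of one crux share the namespace of the crux (tree convention: `Summit.<S>.<S>.…`)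
set_option linter.dupNamespace false

open MeasureTheory Set Filter Topology Metric Function InnerProductSpace
open scoped RealInnerProductSpace NNReal ContDiff

namespace Summit.NavierStokesRegularity.NavierStokesRegularity.Theorems.PowerGaugeEulerLiouville

open Literature.Analysis Literature.Analysis.FluidPDE Literature.Analysis.FunctionSpaces

namespace SwirlRatchet

variable {γ : ℝ} {U : EuclideanSpace ℝ (Fin 3) → EuclideanSpace ℝ (Fin 3)} {P : EuclideanSpace ℝ (Fin 3) → ℝ}

/-! ### The ratchet on solution segments -/

/-- **SWIRL ALONG A BACKWARD SOLUTION SEGMENT**: `Y' = −W(Y)` within `[0, s]` ⇒ `Γ(Y t) = Γ(Y 0)·e^{(1−2γ)t}` for `t ∈ [0, s]`.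
[cite: Chae2007CMPEuler, Thm 2.2 + Note added p. 6] -/
theorem swirl_backward_segment (h : IsSelfSimilarEulerProfile γ 0 U P) (hU : IsAxisymmetric U)
    {Y : ℝ → EuclideanSpace ℝ (Fin 3)} {s : ℝ}
    (hY : ∀ t ∈ Icc 0 s, HasDerivWithinAt Y (-(selfSimilarTransport γ 0 U (Y t))) (Icc 0 s) t) {t : ℝ} (ht : t ∈ Icc 0 s) :
    swirl U (Y t) = swirl U (Y 0) * Real.exp ((1 - 2 * γ) * t) := by
  have hd := h.differentiable_velocity
  set f : ℝ → ℝ := fun σ => swirl U (Y σ) * Real.exp (-((1 - 2 * γ) * σ)) with hf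
  -- right derivatives inside `[0, s)`
  have hYr : ∀ σ ∈ Ico 0 s, HasDerivWithinAt Y (-(selfSimilarTransport γ 0 U (Y σ))) (Ici σ) σ := fun σ hσ =>
    (hY σ (Ico_subset_Icc_self hσ)).mono_of_mem_nhdsWithin
      (mem_of_superset (Icc_mem_nhdsGE hσ.2) (Icc_subset_Icc hσ.1 le_rfl))
  have hderΓ : ∀ σ ∈ Ico 0 s, HasDerivWithinAt (fun σ => swirl U (Y σ)) ((1 - 2 * γ) * swirl U (Y σ)) (Ici σ) σ := by
    intro σ hσ
    have h1 : HasFDerivAt (swirl U) (fderiv ℝ (swirl U) (Y σ)) (Y σ) := (differentiableAt_swirl (hd (Y σ))).hasFDerivAt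
    have h2 := h1.comp_hasDerivWithinAt σ (hYr σ hσ)
    have h3 : fderiv ℝ (swirl U) (Y σ) (-(selfSimilarTransport γ 0 U (Y σ))) = (1 - 2 * γ) * swirl U (Y σ) := by
      rw [map_neg, fderiv_swirl_transport h hU]; ring
    rw [h3] at h2
    exact h2
  have hderf : ∀ σ ∈ Ico 0 t, HasDerivWithinAt f 0 (Ici σ) σ := by
    intro σ hσ
    have hσ' : σ ∈ Ico 0 s := ⟨hσ.1, lt_of_lt_of_le hσ.2 ht.2⟩
    have he : HasDerivWithinAt (fun σ => Real.exp (-((1 - 2 * γ) * σ))) (Real.exp (-((1 - 2 * γ) * σ)) * (-(1 - 2 * γ))) (Ici σ) σ := by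
      have := ((hasDerivAt_id σ).const_mul (1 - 2 * γ)).neg.exp
      simp only [mul_one] at this
      exact this.hasDerivWithinAt
    have hprod := (hderΓ σ hσ').mul he
    have h0 : (1 - 2 * γ) * swirl U (Y σ) * Real.exp (-((1 - 2 * γ) * σ)) +
        swirl U (Y σ) * (Real.exp (-((1 - 2 * γ) * σ)) * -(1 - 2 * γ)) = 0 := by ring
    rw [h0] at hprod
    exact hprod
  have hcont : ContinuousOn f (Icc 0 t) := by
    have hYc : ContinuousOn Y (Icc 0 t) := fun σ hσ =>
      ((hY σ ⟨hσ.1, hσ.2.trans ht.2⟩).continuousWithinAt).mono (Icc_subset_Icc le_rfl ht.2)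
    have hΓc : Continuous (swirl U) := (contDiff_swirl h.contDiff_velocity).continuous
    exact (hΓc.comp_continuousOn hYc).mul ((Real.continuous_exp.comp ((continuous_const.mul continuous_id).neg)).continuousOn)
  have hconst := constant_of_has_deriv_right_zero hcont hderf t (right_mem_Icc.2 ht.1)
  simp only [hf, mul_zero, neg_zero, Real.exp_zero, mul_one] at hconst
  have hexp : Real.exp (-((1 - 2 * γ) * t)) * Real.exp ((1 - 2 * γ) * t) = 1 := by
    rw [← Real.exp_add, neg_add_cancel, Real.exp_zero]
  calc swirl U (Y t) = swirl U (Y t) * (Real.exp (-((1 - 2 * γ) * t)) * Real.exp ((1 - 2 * γ) * t)) := by rw [hexp, mul_one]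
    _ = swirl U (Y 0) * Real.exp ((1 - 2 * γ) * t) := by rw [← mul_assoc, hconst]

/-! ### Global backward orbits from swirling points, growth only on the swirl set -/

/-- **A GLOBAL BACKWARD SIMILARITY ORBIT FROM A SWIRLING POINT, under linear growth ON THE SWIRL SET ONLY.**  `(U, P)` a `C²` self-similar profile, `U` axisymmetric,
`‖U z‖ ≤ K₁(1+‖z‖)` whenever `swirl U z ≠ 0`, and `swirl U y ≠ 0`.  Then some `Y : [0, ∞) → ℝ³` has `Y 0 = y`, `Y' = −W(Y)` (right derivative at `0`,
two-sided for `t > 0`).  (Continuation principle `Literature.Analysis.ODE.exists_solution_Ici_of_apriori_bound`: `W ∈ C¹` is Lipschitz on balls; every solution segment from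
`y` stays in the swirl set by `swirl_backward_segment`, where the growth bound gives Grönwall's a-priori bound.) [cite: Hartman2002, Ch. II Thm. 3.1] -/
theorem exists_backward_orbit_of_swirlGrowth (h : IsSelfSimilarEulerProfile γ 0 U P) (hU : IsAxisymmetric U)
    {K₁ : ℝ} (hlin : ∀ z, swirl U z ≠ 0 → ‖U z‖ ≤ K₁ * (1 + ‖z‖))
    {y : EuclideanSpace ℝ (Fin 3)} (hy : swirl U y ≠ 0) :
    ∃ Y : ℝ → EuclideanSpace ℝ (Fin 3), Y 0 = y ∧
      (∀ t, 0 ≤ t → HasDerivWithinAt Y (-(selfSimilarTransport γ 0 U (Y t))) (Ici 0) t) ∧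
      ∀ t, 0 < t → HasDerivAt Y (-(selfSimilarTransport γ 0 U (Y t))) t := by
  have hK₁ : 0 ≤ K₁ := by
    have h0 := hlin y hy
    have h1 : 0 ≤ K₁ * (1 + ‖y‖) := (norm_nonneg _).trans h0
    by_contra hneg
    push Not at hneg
    have : K₁ * (1 + ‖y‖) < 0 := mul_neg_of_neg_of_pos hneg (by positivity)
    linarith
  -- the backward field
  set Wb : EuclideanSpace ℝ (Fin 3) → EuclideanSpace ℝ (Fin 3) := fun z => -(selfSimilarTransport γ 0 U z) with hWb
  have hWb1 : ContDiff ℝ 1 Wb :=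
    (PowerGaugeEulerLiouville.Kelvin.contDiff_selfSimilarTransport (h.contDiff_velocity.of_le (by norm_num))).neg
  set L : ℝ := |γ| + K₁ + 1 with hL
  have hL0 : 0 < L := by rw [hL]; positivity
  have hgrowth : ∀ z, swirl U z ≠ 0 → ‖Wb z‖ ≤ L * ‖z‖ + K₁ := by
    intro z hz
    rw [hWb]
    simp only [norm_neg, selfSimilarTransport_apply, sub_zero]
    calc ‖γ • z + U z‖ ≤ ‖γ • z‖ + ‖U z‖ := norm_add_le _ _
      _ ≤ |γ| * ‖z‖ + K₁ * (1 + ‖z‖) := by rw [norm_smul, Real.norm_eq_abs]; exact add_le_add le_rfl (hlin z hz)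
      _ ≤ L * ‖z‖ + K₁ := by rw [hL]; nlinarith [norm_nonneg z]
  obtain ⟨Y, hY0, -, hY1, hY2⟩ := Literature.Analysis.ODE.exists_solution_Ici_of_apriori_bound
    (v := fun _ : ℝ => Wb) (x₀ := y)
    (fun _ ρ => by
      obtain ⟨K, hK⟩ := Loc.exists_lipschitzOnWith_closedBall_of_contDiff hWb1 ρ
      exact ⟨K, fun _ _ => hK⟩)
    (fun _ => continuousOn_const)
    (fun T hT => by
      refine ⟨gronwallBound ‖y‖ L K₁ T, ?_, fun s hs α hα0 hα t ht => ?_⟩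
      · have h0 : ‖y‖ ≤ gronwallBound ‖y‖ L K₁ 0 := by rw [gronwallBound_x0]
        exact h0.trans (gronwallBound_mono hL0 hK₁ (norm_nonneg _) le_rfl hT)
      -- the segment stays in the swirl set (ratchet), so the growth bound applies along it
      have hαW : ∀ τ ∈ Icc 0 s, HasDerivWithinAt α (-(selfSimilarTransport γ 0 U (α τ))) (Icc 0 s) τ := fun τ hτ => by
        simpa only [hWb] using hα τ hτ
      have hsw : ∀ τ ∈ Icc 0 s, swirl U (α τ) ≠ 0 := by
        intro τ hτ
        rw [swirl_backward_segment h hU hαW hτ, hα0]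
        exact mul_ne_zero hy (Real.exp_pos _).ne'
      have hcontα : ContinuousOn α (Icc 0 s) := fun τ hτ => (hα τ hτ).continuousWithinAt
      have hder : ∀ τ ∈ Ico 0 s, HasDerivWithinAt α (Wb (α τ)) (Ici τ) τ := fun τ hτ =>
        (hα τ (Ico_subset_Icc_self hτ)).mono_of_mem_nhdsWithin
          (mem_of_superset (Icc_mem_nhdsGE hτ.2) (Icc_subset_Icc hτ.1 le_rfl))
      have hbound : ∀ τ ∈ Ico 0 s, ‖Wb (α τ)‖ ≤ L * ‖α τ‖ + K₁ := fun τ hτ => hgrowth _ (hsw τ (Ico_subset_Icc_self hτ))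
      have hg := norm_le_gronwallBound_of_norm_deriv_right_le hcontα hder (le_of_eq (by rw [hα0])) hbound t ht
      rw [sub_zero] at hg
      exact hg.trans (gronwallBound_mono hL0 hK₁ (norm_nonneg _) le_rfl (ht.2.trans hs.2)))
  refine ⟨Y, hY0, fun t ht => ?_, fun t ht => ?_⟩
  · simpa only [hWb] using hY1 t ht
  · simpa only [hWb] using hY2 t ht

/-! ### The orbit-wise kills with growth on the swirl set only -/

/-- **BOUNDED SWIRL ⇒ NO SWIRL, growth on the swirl set only** (`γ < ½`). [cite: Chae2007CMPEuler, Thm 2.2 + Note added p. 6] -/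
theorem hasNoSwirl_of_bounded_swirl_local (h : IsSelfSimilarEulerProfile γ 0 U P) (hU : IsAxisymmetric U) (hγ2 : γ < 1 / 2)
    {K₁ : ℝ} (hlin : ∀ z, swirl U z ≠ 0 → ‖U z‖ ≤ K₁ * (1 + ‖z‖)) {B : ℝ} (hB : ∀ y, |swirl U y| ≤ B) : HasNoSwirl U := by
  intro y
  by_contra hne
  obtain ⟨Y, hY0, hY, -⟩ := exists_backward_orbit_of_swirlGrowth h hU hlin hne
  have hratchet : ∀ t, 0 ≤ t → swirl U (Y t) = swirl U y * Real.exp ((1 - 2 * γ) * t) := by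
    intro t ht
    rw [← hY0]
    exact swirl_backward_orbit h hU hY ht
  have hpos : 0 < |swirl U y| := abs_pos.2 hne
  have h12 : 0 < 1 - 2 * γ := by linarith
  set t : ℝ := (B / |swirl U y| + 1) / (1 - 2 * γ) with htdef
  have hB0 : 0 ≤ B := (abs_nonneg _).trans (hB y)
  have ht0 : 0 ≤ t := by rw [htdef]; positivity
  have hexp : B / |swirl U y| + 1 < Real.exp ((1 - 2 * γ) * t) := by
    have h1 : (1 - 2 * γ) * t = B / |swirl U y| + 1 := by rw [htdef]; field_simp
    rw [h1]
    linarith [Real.add_one_le_exp (B / |swirl U y| + 1)]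
  have hbig : B < |swirl U (Y t)| := by
    rw [hratchet t ht0, abs_mul, abs_of_pos (Real.exp_pos _)]
    have h2 : B < |swirl U y| * (B / |swirl U y| + 1) := by
      rw [mul_add, mul_div_cancel₀ _ hpos.ne', mul_one]; linarith
    exact h2.trans (mul_lt_mul_of_pos_left hexp hpos)
  exact absurd (hB (Y t)) (not_le.2 hbig)

/-- **`ℋ` BOUNDED ABOVE ON THE SWIRL SET ⇒ NO SWIRL, growth on the swirl set only** (`γ < ½`; the (A1) kinetic budget + the ratchet, as in
`hasNoSwirl_of_bernoulli_le`, with the backward orbit of `exists_backward_orbit_of_swirlGrowth`). [cite: ConstantinIgnatovaVicol2026Putative, §3.4.3 eq. (3.31)] -/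
theorem hasNoSwirl_of_bernoulli_le_local (h : IsSelfSimilarEulerProfile γ 0 U P) (hU : IsAxisymmetric U) (hγ2 : γ < 1 / 2)
    {K₁ : ℝ} (hlin : ∀ z, swirl U z ≠ 0 → ‖U z‖ ≤ K₁ * (1 + ‖z‖)) {Mb : ℝ}
    (hMb : ∀ y, swirl U y ≠ 0 → selfSimilarBernoulli γ 0 U P y ≤ Mb) : HasNoSwirl U := by
  -- adapted from `hasNoSwirl_of_bernoulli_le` (…SwirlBernoulli): only the orbit and the growth evaluations change
  intro y
  by_contra hne
  have hK₁ : 0 ≤ K₁ := by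
    have h0 := hlin y hne
    by_contra hneg
    push Not at hneg
    have : K₁ * (1 + ‖y‖) < 0 := mul_neg_of_neg_of_pos hneg (by positivity)
    linarith [norm_nonneg (U y)]
  have h12 : 0 < 1 - 2 * γ := by linarith
  obtain ⟨Y, hY0, hYw, hYd'⟩ := exists_backward_orbit_of_swirlGrowth h hU hlin hne
  have hYd : ∀ t, 0 < t → HasDerivAt Y ((-1 : ℝ) • selfSimilarTransport γ 0 U (Y t)) t := fun t ht => by
    rw [neg_one_smul]; exact hYd' t ht
  have hratchet : ∀ t, 0 ≤ t → swirl U (Y t) = swirl U y * Real.exp ((1 - 2 * γ) * t) := by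
    intro t ht
    rw [← hY0]
    exact swirl_backward_orbit h hU hYw ht
  have hne' : ∀ t, 0 ≤ t → swirl U (Y t) ≠ 0 := fun t ht => by
    rw [hratchet t ht]; exact mul_ne_zero hne (Real.exp_pos _).ne'
  have hMbY : ∀ t, 0 ≤ t → selfSimilarBernoulli γ 0 U P (Y t) ≤ Mb := fun t ht => hMb _ (hne' t ht)
  set B : ℝ := (Mb - selfSimilarBernoulli γ 0 U P (Y 1)) / (1 - 2 * γ) with hBdef
  have hB0 : 0 ≤ B := by rw [hBdef]; exact div_nonneg (by linarith [hMbY 1 zero_le_one]) h12.le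
  have hesc : ∀ τ, 1 ≤ τ → ‖Y τ‖ ≤ ‖Y 1‖ + (B + (τ - 1)) / 2 := by
    intro τ hτ
    have hYI : ∀ t ∈ Icc 1 τ, HasDerivAt Y ((-1 : ℝ) • selfSimilarTransport γ 0 U (Y t)) t :=
      fun t ht => hYd t (by linarith [ht.1])
    have hbud := Loc.integral_norm_transport_sq_eq h hτ hYI
    have hI : ∫ t in (1 : ℝ)..τ, ‖selfSimilarTransport γ 0 U (Y t)‖ ^ 2 ≤ B := by
      rw [hBdef, le_div_iff₀ h12, mul_comm]
      rw [hbud]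
      linarith [hMbY τ (by linarith)]
    have hd := norm_sub_le_of_kinetic_budget h hτ hYI hI
    have h1 : ‖Y τ‖ ≤ ‖Y 1‖ + ‖Y τ - Y 1‖ := norm_le_insert' _ _
    linarith
  set α : ℝ := ‖Y 1‖ + B / 2 with hαdef
  have hα0 : 0 ≤ α := by rw [hαdef]; positivity
  have hesc' : ∀ τ, 1 ≤ τ → ‖Y τ‖ ≤ α + τ := fun τ hτ => by have := hesc τ hτ; rw [hαdef]; linarith
  have hpos : 0 < |swirl U y| := abs_pos.2 hne
  set c : ℝ := 1 - 2 * γ with hc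
  set τ : ℝ := max (max 1 α) (48 * K₁ / (|swirl U y| * c ^ 3) + 1) with hτdef
  have hτ1 : 1 ≤ τ := le_trans (le_max_left 1 α) (le_max_left _ _)
  have hτα : α ≤ τ := le_trans (le_max_right 1 α) (le_max_left _ _)
  have hτK : 48 * K₁ / (|swirl U y| * c ^ 3) < τ := lt_of_lt_of_le (lt_add_one _) (le_max_right _ _)
  have hτ0 : 0 < τ := by linarith
  have hup : |swirl U (Y τ)| ≤ 8 * K₁ * τ ^ 2 := by
    have hn : ‖Y τ‖ ≤ 2 * τ := by linarith [hesc' τ hτ1]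
    have hn0 : 0 ≤ ‖Y τ‖ := norm_nonneg _
    calc |swirl U (Y τ)| ≤ ‖Y τ‖ * ‖U (Y τ)‖ := by
          rw [swirl_eq_inner_rotGen]
          exact (abs_real_inner_le_norm _ _).trans
            (mul_le_mul_of_nonneg_right (PineauVicol2026.norm_rotGen_le (Y τ)) (norm_nonneg _))
      _ ≤ ‖Y τ‖ * (K₁ * (1 + ‖Y τ‖)) := mul_le_mul_of_nonneg_left (hlin _ (hne' τ hτ0.le)) hn0
      _ ≤ (2 * τ) * (K₁ * (1 + 2 * τ)) := by gcongr
      _ ≤ 8 * K₁ * τ ^ 2 := by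
          have h1 : 0 ≤ 2 * K₁ * τ * (2 * τ - 1) :=
            mul_nonneg (mul_nonneg (mul_nonneg (by norm_num) hK₁) hτ0.le) (by linarith)
          nlinarith [h1]
  have hlow : |swirl U y| * ((c * τ) ^ 3 / 6) ≤ |swirl U (Y τ)| := by
    rw [hratchet τ hτ0.le, abs_mul, abs_of_pos (Real.exp_pos _)]
    refine mul_le_mul_of_nonneg_left ?_ hpos.le
    have h1 := Real.pow_div_factorial_le_exp (c * τ) (show 0 ≤ c * τ by positivity) 3
    have h2 : ((Nat.factorial 3 : ℕ) : ℝ) = 6 := by norm_num [Nat.factorial]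
    rw [h2] at h1
    exact h1
  have hfin : |swirl U y| * ((c * τ) ^ 3 / 6) ≤ 8 * K₁ * τ ^ 2 := hlow.trans hup
  have hcontra : τ ≤ 48 * K₁ / (|swirl U y| * c ^ 3) := by
    rw [le_div_iff₀ (by positivity)]
    have e : |swirl U y| * ((c * τ) ^ 3 / 6) = (τ * (|swirl U y| * c ^ 3)) * τ ^ 2 / 6 := by ring
    rw [e] at hfin
    have hτ2 : 0 < τ ^ 2 := by positivity
    nlinarith
  linarith

end SwirlRatchet

/-! ### Member forms -/

namespace SwirlRatchet

variable {u : ℝ → EuclideanSpace ℝ (Fin 3) → EuclideanSpace ℝ (Fin 3)} {p : ℝ → EuclideanSpace ℝ (Fin 3) → ℝ}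
  {H : ℝ → EuclideanSpace ℝ (Fin 3) → EuclideanSpace ℝ (Fin 3) →L[ℝ] EuclideanSpace ℝ (Fin 3)} {c : ℝ≥0}
  {V : EuclideanSpace ℝ (Fin 3) → EuclideanSpace ℝ (Fin 3)} {P : EuclideanSpace ℝ (Fin 3) → ℝ}

/-- **MEMBER FORM: bounded swirl, linear growth ON THE SWIRL SET only** (crux binders + exactly self-similar ansatz + `ContDiff ℝ 2 V` + `IsAxisymmetric V` +
`∃ K₁, ∀ y, swirl V y ≠ 0 → ‖V y‖ ≤ K₁(1+‖y‖)` + `∃ B, ∀ y, |swirl V y| ≤ B` ⇒ `u = 0` a.e.). [cite: Chae2007CMPEuler, Thm 2.2 + Note added p. 6] -/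
theorem selfSimilar_ae_eq_zero_of_axisym_boundedSwirl_C2_local {ρ : ℝ} (hρ : 0 < ρ) (hρ1 : ρ ≤ 1 / 2)
    (hsw : IsSuitableWeakSolutionOn (slab (EuclideanSpace ℝ (Fin 3)) (Iio 0) isOpen_Iio) 0 0 u p)
    (hH : HasWeakSpatialGradientOn (slab (EuclideanSpace ℝ (Fin 3)) (Iio 0) isOpen_Iio) u H)
    (hgauge : ∀ a : ℝ, 0 < a →
      ENNReal.ofReal (a ^ (2 * ρ)) * cknA a (0 : ℝ × EuclideanSpace ℝ (Fin 3)) u +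
          ENNReal.ofReal (a ^ ρ) * cknE a (0 : ℝ × EuclideanSpace ℝ (Fin 3)) H +
        ENNReal.ofReal (a ^ (2 * ρ)) * cknD a (0 : ℝ × EuclideanSpace ℝ (Fin 3)) p ≤ (c : ENNReal))
    (hu : ∀ τ : ℝ, τ < 0 → u τ = selfSimilarCollapse (1 / (2 + ρ)) 0 V τ)
    (hp : ∀ τ : ℝ, τ < 0 → p τ = selfSimilarCollapsePressure (1 / (2 + ρ)) 0 P τ)
    (hV : ContDiff ℝ 2 V) (hax : IsAxisymmetric V)
    (hlin : ∃ K₁ : ℝ, ∀ y, swirl V y ≠ 0 → ‖V y‖ ≤ K₁ * (1 + ‖y‖)) (hbdd : ∃ B : ℝ, ∀ y, |swirl V y| ≤ B) :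
    uncurry u =ᵐ[volume.restrict (Iio (0 : ℝ) ×ˢ (univ : Set (EuclideanSpace ℝ (Fin 3))))] 0 := by
  obtain ⟨K₁, hK₁⟩ := hlin
  obtain ⟨B, hB⟩ := hbdd
  have hρ1' : ρ < 1 := by linarith
  have h2ρ : (0 : ℝ) < 2 + ρ := by linarith
  have hγ2 : 1 / (2 + ρ) < 1 / 2 := one_div_lt_one_div_of_lt two_pos (by linarith)
  have hD : ∀ a : ℝ, 0 < a → ENNReal.ofReal (a ^ (2 * ρ)) *
      cknD a (0 : ℝ × EuclideanSpace ℝ (Fin 3)) p ≤ (c : ENNReal) :=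
    fun a ha => le_trans le_add_self (hgauge a ha)
  have hpm : AEStronglyMeasurable (uncurry p)
      (volume.restrict (Iio (0 : ℝ) ×ˢ (univ : Set (EuclideanSpace ℝ (Fin 3))))) := by
    have := hsw.distributional.2.2.1.aestronglyMeasurable
    simpa [slab] using this
  have hPm := aestronglyMeasurable_pressureProfile hpm hp
  have hDprof := profile_pressure_weight_of_gaugeD hρ hρ1' hpm hp hD
  have hP1 : LocallyIntegrable P volume :=
    EnergySaturation.locallyIntegrable_pressure_of_weight hρ1' hPm
      (ENNReal.mul_ne_top ENNReal.ofReal_ne_top ENNReal.coe_ne_top) hDprof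
  obtain ⟨P', hprof⟩ := WeakToClassical.exists_isSelfSimilarEulerProfile_of_contDiff hsw.distributional hu hp hV hP1
  have hns : HasNoSwirl V := hasNoSwirl_of_bounded_swirl_local hprof hax hγ2 hK₁ hB
  exact NeedleRace.selfSimilar_ae_eq_zero_of_axisymNoSwirlC2 hρ hρ1 hsw hH hgauge hu hp hV hax hns

/-- **MEMBER FORM: `ℋ` bounded above on the swirl set, linear growth ON THE SWIRL SET only** (crux binders + exactly self-similar ansatz + `ContDiff ℝ 2 V` +
`IsAxisymmetric V` + `∃ K₁, ∀ y, swirl V y ≠ 0 → ‖V y‖ ≤ K₁(1+‖y‖)` + «for every classical pressure `P′`, `ℋ_{P′}` bounded above on `{swirl V ≠ 0}`» ⇒ `u = 0` a.e.).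
[cite: ConstantinIgnatovaVicol2026Putative, §3.4.3 eq. (3.31)] -/
theorem selfSimilar_ae_eq_zero_of_axisym_bernoulliBounded_C2_local {ρ : ℝ} (hρ : 0 < ρ) (hρ1 : ρ ≤ 1 / 2)
    (hsw : IsSuitableWeakSolutionOn (slab (EuclideanSpace ℝ (Fin 3)) (Iio 0) isOpen_Iio) 0 0 u p)
    (hH : HasWeakSpatialGradientOn (slab (EuclideanSpace ℝ (Fin 3)) (Iio 0) isOpen_Iio) u H)
    (hgauge : ∀ a : ℝ, 0 < a →
      ENNReal.ofReal (a ^ (2 * ρ)) * cknA a (0 : ℝ × EuclideanSpace ℝ (Fin 3)) u +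
          ENNReal.ofReal (a ^ ρ) * cknE a (0 : ℝ × EuclideanSpace ℝ (Fin 3)) H +
        ENNReal.ofReal (a ^ (2 * ρ)) * cknD a (0 : ℝ × EuclideanSpace ℝ (Fin 3)) p ≤ (c : ENNReal))
    (hu : ∀ τ : ℝ, τ < 0 → u τ = selfSimilarCollapse (1 / (2 + ρ)) 0 V τ)
    (hp : ∀ τ : ℝ, τ < 0 → p τ = selfSimilarCollapsePressure (1 / (2 + ρ)) 0 P τ)
    (hV : ContDiff ℝ 2 V) (hax : IsAxisymmetric V)
    (hlin : ∃ K₁ : ℝ, ∀ y, swirl V y ≠ 0 → ‖V y‖ ≤ K₁ * (1 + ‖y‖))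
    (hB : ∀ P' : EuclideanSpace ℝ (Fin 3) → ℝ, IsSelfSimilarEulerProfile (1 / (2 + ρ)) 0 V P' →
      ∃ Mb : ℝ, ∀ y, swirl V y ≠ 0 → selfSimilarBernoulli (1 / (2 + ρ)) 0 V P' y ≤ Mb) :
    uncurry u =ᵐ[volume.restrict (Iio (0 : ℝ) ×ˢ (univ : Set (EuclideanSpace ℝ (Fin 3))))] 0 := by
  obtain ⟨K₁, hK₁⟩ := hlin
  have hρ1' : ρ < 1 := by linarith
  have h2ρ : (0 : ℝ) < 2 + ρ := by linarith
  have hγ2 : 1 / (2 + ρ) < 1 / 2 := one_div_lt_one_div_of_lt two_pos (by linarith)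
  have hD : ∀ a : ℝ, 0 < a → ENNReal.ofReal (a ^ (2 * ρ)) *
      cknD a (0 : ℝ × EuclideanSpace ℝ (Fin 3)) p ≤ (c : ENNReal) :=
    fun a ha => le_trans le_add_self (hgauge a ha)
  have hpm : AEStronglyMeasurable (uncurry p)
      (volume.restrict (Iio (0 : ℝ) ×ˢ (univ : Set (EuclideanSpace ℝ (Fin 3))))) := by
    have := hsw.distributional.2.2.1.aestronglyMeasurable
    simpa [slab] using this
  have hPm := aestronglyMeasurable_pressureProfile hpm hp
  have hDprof := profile_pressure_weight_of_gaugeD hρ hρ1' hpm hp hD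
  have hP1 : LocallyIntegrable P volume :=
    EnergySaturation.locallyIntegrable_pressure_of_weight hρ1' hPm
      (ENNReal.mul_ne_top ENNReal.ofReal_ne_top ENNReal.coe_ne_top) hDprof
  obtain ⟨P', hprof⟩ := WeakToClassical.exists_isSelfSimilarEulerProfile_of_contDiff hsw.distributional hu hp hV hP1
  obtain ⟨Mb, hMb⟩ := hB P' hprof
  have hns : HasNoSwirl V := hasNoSwirl_of_bernoulli_le_local hprof hax hγ2 hK₁ hMb
  exact NeedleRace.selfSimilar_ae_eq_zero_of_axisymNoSwirlC2 hρ hρ1 hsw hH hgauge hu hp hV hax hns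

end SwirlRatchet

end Summit.NavierStokesRegularity.NavierStokesRegularity.Theorems.PowerGaugeEulerLiouville

end
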